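import Summits.Ventures.Crystal3D.Theorems.StickyWulffConstantPolycrystalWulffBoundRecolourMove
import Summits.Ventures.Crystal3D.Theorems.StickyWulffConstantPolycrystalWulffBoundDeleteMove
import Summits.Ventures.Crystal3D.Theorems.StickyWulffConstantPolycrystalWulffBoundAggPrelim

/-!
# `PolycrystalWulffBound`, line `PolyDensity`: the RECOLOURING and DELETION rows under an induction hypothesis

Route `StickyWulffConstant` of the venture `Summits/Ventures/Crystal3D`, crux `PolycrystalWulffBound`
(item `stmt-Ventures-19482`), second prover lane (poly-p2, gen 4).  The all-`m` middle band (memo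
`poly-p2/MIDDLE-BAND-g4.md` §12–13, `def AggCert27_8`) is an induction on the number of lattice classes; its
`rec` rows come from `recolour_move` applied to a class-closed set `S` of grains and the induction hypothesis for
the recoloured texture, which has strictly fewer classes (`card_image_recolour_lt`).  `rec_row_of_IH` packages
exactly this: given the bound for every admissible re-labelling `A'` of the same grains with fewer classes, the
polycrystal Wulff constant is at most `En + (√5−√3)·Y_S − (cross-class interfaces inside S ∪ class(ℓ₀))`;
`del_row_of_IH` is the companion for `delete_move` (the grains of `S` removed; the induction hypothesis ranges
over all textures on the same index set with fewer classes, so both rows take the same `hIH`).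
WHAT THIS IS NOT: the class-level bookkeeping of `Y_S` and the interface terms (see `threeClass_core`); F-C1 not moved.
-/

noncomputable section

open scoped BigOperators InnerProductSpace ENNReal
open MeasureTheory Filter

namespace Summit.Ventures.Crystal3D.Cruxes.PolycrystalWulffBound.PolyDensity

open Summit.Ventures.Crystal3D.Theorems

/-- **Recolouring row under the induction hypothesis.**  See the module docstring. -/
theorem rec_row_of_IH :
    let Λ : Set (EuclideanSpace ℝ (Fin 3)) := Literature.MathematicalPhysics.StatisticalMechanics.fccStacking 1 (Real.sqrt (2 / 3));
    let Brl : (ℤ → ℤ) → Set (EuclideanSpace ℝ (Fin 3)) := Literature.MathematicalPhysics.StatisticalMechanics.barlowStacking 1 (Real.sqrt (2 / 3));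
    let Ax : EuclideanSpace ℝ (Fin 3) → (EuclideanSpace ℝ (Fin 3) ≃ₗᵢ[ℝ] EuclideanSpace ℝ (Fin 3)) → (EuclideanSpace ℝ (Fin 3) ≃ₗᵢ[ℝ] EuclideanSpace ℝ (Fin 3)) → Prop := fun m A B => ∃ (L : EuclideanSpace ℝ (Fin 3) ≃ₗᵢ[ℝ] EuclideanSpace ℝ (Fin 3)) (s₁ s₂ : EuclideanSpace ℝ (Fin 3)) (σ σ' : ℤ → ℤ), Literature.MathematicalPhysics.StatisticalMechanics.IsHaggSeq σ ∧ Literature.MathematicalPhysics.StatisticalMechanics.IsHaggSeq σ' ∧ L (EuclideanSpace.single (2 : Fin 3) (1 : ℝ)) = m ∧ A '' Λ ⊆ (fun q => L q + s₁) '' Brl σ ∧ B '' Λ ⊆ (fun q => L q + s₂) '' Brl σ';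
    let CoAx : (EuclideanSpace ℝ (Fin 3) ≃ₗᵢ[ℝ] EuclideanSpace ℝ (Fin 3)) → (EuclideanSpace ℝ (Fin 3) ≃ₗᵢ[ℝ] EuclideanSpace ℝ (Fin 3)) → Prop := fun A B => ∃ m, Ax m A B;
    let Φ : EuclideanSpace ℝ (Fin 3) → ℝ := fun ν => Real.sqrt 2 / 4 * ∑ᶠ w ∈ {w ∈ Λ | ‖w‖ = 1}, |⟪w, ν⟫_ℝ|;
    let Per : Set (EuclideanSpace ℝ (Fin 3)) → Set (EuclideanSpace ℝ (Fin 3)) → ℝ := fun K S => (⨆ (ξ : EuclideanSpace ℝ (Fin 3) → EuclideanSpace ℝ (Fin 3)) (_ : ContDiff ℝ 1 ξ ∧ HasCompactSupport ξ ∧ ∀ z, ξ z ∈ K), ENNReal.ofReal (∫ z in S, Literature.MathematicalPhysics.StatisticalMechanics.fieldDivergence ξ z)).toReal;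
    let ι : Set (EuclideanSpace ℝ (Fin 3)) → Set (EuclideanSpace ℝ (Fin 3)) → Set (EuclideanSpace ℝ (Fin 3)) → ℝ := fun K S₁ S₂ => (Per K S₁ + Per K S₂ - Per K (S₁ ∪ S₂)) / 2;
    let W : (EuclideanSpace ℝ (Fin 3) ≃ₗᵢ[ℝ] EuclideanSpace ℝ (Fin 3)) → Set (EuclideanSpace ℝ (Fin 3)) := fun A => {y | ∀ ν : EuclideanSpace ℝ (Fin 3), ⟪y, ν⟫_ℝ ≤ Φ (A.symm ν)};
    let Dsc : EuclideanSpace ℝ (Fin 3) → Set (EuclideanSpace ℝ (Fin 3)) := fun m => {y | ‖y‖ ≤ 1 ∧ ⟪y, m⟫_ℝ = 0};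
    let Tex : (n : ℕ) → (Fin n → Set (EuclideanSpace ℝ (Fin 3))) → (Fin n → (EuclideanSpace ℝ (Fin 3) ≃ₗᵢ[ℝ] EuclideanSpace ℝ (Fin 3))) → (Fin n → Fin n → ℝ) → (Fin n → Fin n → EuclideanSpace ℝ (Fin 3)) → Prop := fun n G A c m => (∀ f : Fin n, Literature.MathematicalPhysics.StatisticalMechanics.HasFinitePerimeter (G f) ∧ volume (G f) < ⊤) ∧ (∀ f g, f ≠ g → Disjoint (G f) (G g)) ∧ (∀ f g, f ≠ g → 0 ≤ c f g) ∧ (∀ f g, f ≠ g → ¬ CoAx (A f) (A g) → m f g = 0 ∧ 1 ≤ c f g) ∧ (∀ f g, f ≠ g → CoAx (A f) (A g) → A f '' Λ ≠ A g '' Λ → Ax (m f g) (A f) (A g) ∧ 1 / 2 ≤ c f g);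
    let En : (n : ℕ) → (Fin n → Set (EuclideanSpace ℝ (Fin 3))) → (Fin n → (EuclideanSpace ℝ (Fin 3) ≃ₗᵢ[ℝ] EuclideanSpace ℝ (Fin 3))) → (Fin n → Fin n → ℝ) → (Fin n → Fin n → EuclideanSpace ℝ (Fin 3)) → ℝ := fun n G A c m => ∑ f : Fin n, Per (W (A f)) (G f) - ∑ f, ∑ g, (if f = g then 0 else ι (W (A f)) (G f) (G g)) + ∑ f, ∑ g, (if f = g then 0 else c f g / 2 * ι (Dsc (m f g)) (G f) (G g));
    let Vol : (n : ℕ) → (Fin n → Set (EuclideanSpace ℝ (Fin 3))) → ℝ := fun n G => (volume (⋃ f : Fin n, G f)).toReal;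
    let Poly : Set (EuclideanSpace ℝ (Fin 3)) → Prop := fun S => ∃ (k : ℕ) (H : Fin k → Finset ((EuclideanSpace ℝ (Fin 3)) × ℝ)), S = ⋃ i, ⋂ p ∈ H i, {x | ⟪p.1, x⟫_ℝ < p.2};
    let TF : (n : ℕ) → (Fin n → (EuclideanSpace ℝ (Fin 3) ≃ₗᵢ[ℝ] EuclideanSpace ℝ (Fin 3))) → Prop := fun n A => ∀ f g : Fin n, f ≠ g → CoAx (A f) (A g) → A f '' Λ = A g '' Λ;
    ∀ (n : ℕ) (G : Fin n → Set (EuclideanSpace ℝ (Fin 3))) (A : Fin n → (EuclideanSpace ℝ (Fin 3) ≃ₗᵢ[ℝ] EuclideanSpace ℝ (Fin 3))) (c : Fin n → Fin n → ℝ) (m : Fin n → Fin n → EuclideanSpace ℝ (Fin 3))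
      (β : Type) [DecidableEq β] (cls : Fin n → β) (S : Finset (Fin n)) (ℓ₀ : Fin n),
      Tex n G A c m → (∀ f, Poly (G f)) → TF n A →
      (∀ f g : Fin n, cls f = cls g ↔ A f '' Λ = A g '' Λ) → (∀ f g : Fin n, cls f = cls g → f ∈ S → g ∈ S) → ℓ₀ ∉ S →
      S.Nonempty →
      (∀ (G' : Fin n → Set (EuclideanSpace ℝ (Fin 3))) (A' : Fin n → (EuclideanSpace ℝ (Fin 3) ≃ₗᵢ[ℝ] EuclideanSpace ℝ (Fin 3)))
        (c' : Fin n → Fin n → ℝ) (m' : Fin n → Fin n → EuclideanSpace ℝ (Fin 3)),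
        Tex n G' A' c' m' → (∀ f, Poly (G' f)) → TF n A' →
        (Finset.univ.image fun f => A' f '' Λ).card < (Finset.univ.image fun f => A f '' Λ).card →
        6 * (2 : ℝ) ^ ((1 : ℝ) / 3) * (Real.sqrt 2 * Vol n G') ^ ((2 : ℝ) / 3) ≤ En n G' A' c' m') →
      6 * (2 : ℝ) ^ ((1 : ℝ) / 3) * (Real.sqrt 2 * Vol n G) ^ ((2 : ℝ) / 3) ≤ En n G A c m
        + (Real.sqrt 5 - Real.sqrt 3) * (∑ f ∈ S, (Per (Metric.closedBall (0 : EuclideanSpace ℝ (Fin 3)) 1) (G f)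
            - ∑ g, (if f = g then 0 else ι (Metric.closedBall (0 : EuclideanSpace ℝ (Fin 3)) 1) (G f) (G g))))
        - (∑ f, ∑ g, (if f ≠ g ∧ (f ∈ S ∨ cls f = cls ℓ₀) ∧ (g ∈ S ∨ cls g = cls ℓ₀) ∧ cls f ≠ cls g
            then ι (Metric.closedBall (0 : EuclideanSpace ℝ (Fin 3)) 1) (G f) (G g) / 2 else 0)) := by
  intro Λ Brl Ax CoAx Φ Per ι W Dsc Tex En Vol Poly TF n G A c m β _ cls S ℓ₀ hTex hPoly hTF hcls hS hℓ₀ hne hIH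
  classical
  obtain ⟨hTex', hTF', hineq⟩ := recolour_move n G A c m β cls S ℓ₀ hTex hPoly hTF hcls hS hℓ₀
  have hlt := card_image_recolour_lt (fun f => A f '' Λ) S ℓ₀ hℓ₀ (fun f g hfg hf => hS f g ((hcls f g).2 hfg) hf) hne
  have hfun : (fun f => ((if f ∈ S then A ℓ₀ else A f : EuclideanSpace ℝ (Fin 3) ≃ₗᵢ[ℝ] EuclideanSpace ℝ (Fin 3)) :
      EuclideanSpace ℝ (Fin 3) → EuclideanSpace ℝ (Fin 3)) '' Λ) = (fun f => if f ∈ S then A ℓ₀ '' Λ else A f '' Λ) := by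
    funext f; split_ifs <;> rfl
  have hb := hIH G (fun f => if f ∈ S then A ℓ₀ else A f) _ m hTex' hPoly hTF' (by rw [hfun]; exact hlt)
  linarith

/-- **Deletion row under the induction hypothesis.**  `delete_move` for a class-closed set `S` of grains
(recoloured to the lattice of `g₀ ∉ S` and emptied) and the induction hypothesis for the smaller texture give
`κ(Vol − |S-grains|) ≤ En − Fr_S + (√5−1)·(interfaces S | Sᶜ) − (cross-class interfaces inside S)`. -/
theorem del_row_of_IH :
    let Λ : Set (EuclideanSpace ℝ (Fin 3)) := Literature.MathematicalPhysics.StatisticalMechanics.fccStacking 1 (Real.sqrt (2 / 3));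
    let Brl : (ℤ → ℤ) → Set (EuclideanSpace ℝ (Fin 3)) := Literature.MathematicalPhysics.StatisticalMechanics.barlowStacking 1 (Real.sqrt (2 / 3));
    let Ax : EuclideanSpace ℝ (Fin 3) → (EuclideanSpace ℝ (Fin 3) ≃ₗᵢ[ℝ] EuclideanSpace ℝ (Fin 3)) → (EuclideanSpace ℝ (Fin 3) ≃ₗᵢ[ℝ] EuclideanSpace ℝ (Fin 3)) → Prop := fun m A B => ∃ (L : EuclideanSpace ℝ (Fin 3) ≃ₗᵢ[ℝ] EuclideanSpace ℝ (Fin 3)) (s₁ s₂ : EuclideanSpace ℝ (Fin 3)) (σ σ' : ℤ → ℤ), Literature.MathematicalPhysics.StatisticalMechanics.IsHaggSeq σ ∧ Literature.MathematicalPhysics.StatisticalMechanics.IsHaggSeq σ' ∧ L (EuclideanSpace.single (2 : Fin 3) (1 : ℝ)) = m ∧ A '' Λ ⊆ (fun q => L q + s₁) '' Brl σ ∧ B '' Λ ⊆ (fun q => L q + s₂) '' Brl σ';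
    let CoAx : (EuclideanSpace ℝ (Fin 3) ≃ₗᵢ[ℝ] EuclideanSpace ℝ (Fin 3)) → (EuclideanSpace ℝ (Fin 3) ≃ₗᵢ[ℝ] EuclideanSpace ℝ (Fin 3)) → Prop := fun A B => ∃ m, Ax m A B;
    let Φ : EuclideanSpace ℝ (Fin 3) → ℝ := fun ν => Real.sqrt 2 / 4 * ∑ᶠ w ∈ {w ∈ Λ | ‖w‖ = 1}, |⟪w, ν⟫_ℝ|;
    let Per : Set (EuclideanSpace ℝ (Fin 3)) → Set (EuclideanSpace ℝ (Fin 3)) → ℝ := fun K S => (⨆ (ξ : EuclideanSpace ℝ (Fin 3) → EuclideanSpace ℝ (Fin 3)) (_ : ContDiff ℝ 1 ξ ∧ HasCompactSupport ξ ∧ ∀ z, ξ z ∈ K), ENNReal.ofReal (∫ z in S, Literature.MathematicalPhysics.StatisticalMechanics.fieldDivergence ξ z)).toReal;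
    let ι : Set (EuclideanSpace ℝ (Fin 3)) → Set (EuclideanSpace ℝ (Fin 3)) → Set (EuclideanSpace ℝ (Fin 3)) → ℝ := fun K S₁ S₂ => (Per K S₁ + Per K S₂ - Per K (S₁ ∪ S₂)) / 2;
    let W : (EuclideanSpace ℝ (Fin 3) ≃ₗᵢ[ℝ] EuclideanSpace ℝ (Fin 3)) → Set (EuclideanSpace ℝ (Fin 3)) := fun A => {y | ∀ ν : EuclideanSpace ℝ (Fin 3), ⟪y, ν⟫_ℝ ≤ Φ (A.symm ν)};
    let Dsc : EuclideanSpace ℝ (Fin 3) → Set (EuclideanSpace ℝ (Fin 3)) := fun m => {y | ‖y‖ ≤ 1 ∧ ⟪y, m⟫_ℝ = 0};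
    let Tex : (n : ℕ) → (Fin n → Set (EuclideanSpace ℝ (Fin 3))) → (Fin n → (EuclideanSpace ℝ (Fin 3) ≃ₗᵢ[ℝ] EuclideanSpace ℝ (Fin 3))) → (Fin n → Fin n → ℝ) → (Fin n → Fin n → EuclideanSpace ℝ (Fin 3)) → Prop := fun n G A c m => (∀ f : Fin n, Literature.MathematicalPhysics.StatisticalMechanics.HasFinitePerimeter (G f) ∧ volume (G f) < ⊤) ∧ (∀ f g, f ≠ g → Disjoint (G f) (G g)) ∧ (∀ f g, f ≠ g → 0 ≤ c f g) ∧ (∀ f g, f ≠ g → ¬ CoAx (A f) (A g) → m f g = 0 ∧ 1 ≤ c f g) ∧ (∀ f g, f ≠ g → CoAx (A f) (A g) → A f '' Λ ≠ A g '' Λ → Ax (m f g) (A f) (A g) ∧ 1 / 2 ≤ c f g);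
    let En : (n : ℕ) → (Fin n → Set (EuclideanSpace ℝ (Fin 3))) → (Fin n → (EuclideanSpace ℝ (Fin 3) ≃ₗᵢ[ℝ] EuclideanSpace ℝ (Fin 3))) → (Fin n → Fin n → ℝ) → (Fin n → Fin n → EuclideanSpace ℝ (Fin 3)) → ℝ := fun n G A c m => ∑ f : Fin n, Per (W (A f)) (G f) - ∑ f, ∑ g, (if f = g then 0 else ι (W (A f)) (G f) (G g)) + ∑ f, ∑ g, (if f = g then 0 else c f g / 2 * ι (Dsc (m f g)) (G f) (G g));
    let Vol : (n : ℕ) → (Fin n → Set (EuclideanSpace ℝ (Fin 3))) → ℝ := fun n G => (volume (⋃ f : Fin n, G f)).toReal;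
    let Poly : Set (EuclideanSpace ℝ (Fin 3)) → Prop := fun S => ∃ (k : ℕ) (H : Fin k → Finset ((EuclideanSpace ℝ (Fin 3)) × ℝ)), S = ⋃ i, ⋂ p ∈ H i, {x | ⟪p.1, x⟫_ℝ < p.2};
    let TF : (n : ℕ) → (Fin n → (EuclideanSpace ℝ (Fin 3) ≃ₗᵢ[ℝ] EuclideanSpace ℝ (Fin 3))) → Prop := fun n A => ∀ f g : Fin n, f ≠ g → CoAx (A f) (A g) → A f '' Λ = A g '' Λ;
    ∀ (n : ℕ) (G : Fin n → Set (EuclideanSpace ℝ (Fin 3))) (A : Fin n → (EuclideanSpace ℝ (Fin 3) ≃ₗᵢ[ℝ] EuclideanSpace ℝ (Fin 3))) (c : Fin n → Fin n → ℝ) (m : Fin n → Fin n → EuclideanSpace ℝ (Fin 3))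
      (β : Type) [DecidableEq β] (cls : Fin n → β) (S : Finset (Fin n)) (g₀ : Fin n),
      Tex n G A c m → (∀ f, Poly (G f)) → TF n A →
      (∀ f g : Fin n, cls f = cls g ↔ A f '' Λ = A g '' Λ) → (∀ f g : Fin n, cls f = cls g → f ∈ S → g ∈ S) → g₀ ∉ S →
      S.Nonempty →
      (∀ (G' : Fin n → Set (EuclideanSpace ℝ (Fin 3))) (A' : Fin n → (EuclideanSpace ℝ (Fin 3) ≃ₗᵢ[ℝ] EuclideanSpace ℝ (Fin 3)))
        (c' : Fin n → Fin n → ℝ) (m' : Fin n → Fin n → EuclideanSpace ℝ (Fin 3)),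
        Tex n G' A' c' m' → (∀ f, Poly (G' f)) → TF n A' →
        (Finset.univ.image fun f => A' f '' Λ).card < (Finset.univ.image fun f => A f '' Λ).card →
        6 * (2 : ℝ) ^ ((1 : ℝ) / 3) * (Real.sqrt 2 * Vol n G') ^ ((2 : ℝ) / 3) ≤ En n G' A' c' m') →
      6 * (2 : ℝ) ^ ((1 : ℝ) / 3) * (Real.sqrt 2 * (Vol n G - ∑ f ∈ S, (volume (G f)).toReal)) ^ ((2 : ℝ) / 3) ≤ En n G A c m
        - (∑ f ∈ S, (Per (W (A f)) (G f) - ∑ g, (if f = g then 0 else ι (W (A f)) (G f) (G g))))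
        + (Real.sqrt 5 - 1) * (∑ f, ∑ g, (if f ∉ S ∧ g ∈ S then ι (Metric.closedBall (0 : EuclideanSpace ℝ (Fin 3)) 1) (G f) (G g) else 0))
        - (∑ f, ∑ g, (if f ≠ g ∧ f ∈ S ∧ g ∈ S ∧ cls f ≠ cls g
            then ι (Metric.closedBall (0 : EuclideanSpace ℝ (Fin 3)) 1) (G f) (G g) / 2 else 0)) := by
  intro Λ Brl Ax CoAx Φ Per ι W Dsc Tex En Vol Poly TF n G A c m β _ cls S g₀ hTex hPoly hTF hcls hS hg₀ hne hIH
  classical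
  obtain ⟨hTex', hPoly', hTF', hvol, hineq⟩ := delete_move n G A c m β cls S g₀ hTex hPoly hTF hcls hS hg₀
  have hlt := card_image_recolour_lt (fun f => A f '' Λ) S g₀ hg₀ (fun f g hfg hf => hS f g ((hcls f g).2 hfg) hf) hne
  have hfun : (fun f => ((if f ∈ S then A g₀ else A f : EuclideanSpace ℝ (Fin 3) ≃ₗᵢ[ℝ] EuclideanSpace ℝ (Fin 3)) :
      EuclideanSpace ℝ (Fin 3) → EuclideanSpace ℝ (Fin 3)) '' Λ) = (fun f => if f ∈ S then A g₀ '' Λ else A f '' Λ) := by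
    funext f; split_ifs <;> rfl
  have hb := hIH (fun f => if f ∈ S then ∅ else G f) (fun f => if f ∈ S then A g₀ else A f) _ _ hTex' hPoly' hTF'
    (by rw [hfun]; exact hlt)
  have hV : Vol n (fun f => if f ∈ S then ∅ else G f) = Vol n G - ∑ f ∈ S, (volume (G f)).toReal := by
    show (volume (⋃ f, (fun f => if f ∈ S then (∅ : Set (EuclideanSpace ℝ (Fin 3))) else G f) f)).toReal = (volume (⋃ f, G f)).toReal - _
    linarith [hvol]
  rw [hV] at hb
  linarith

end Summit.Ventures.Crystal3D.Cruxes.PolycrystalWulffBound.PolyDensity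

end
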